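import Literature.NumberTheory.Rogawski1990.ArchBouazizClassMultiplierG        -- ★ (7) F4 (F0P3a-p04 (g27)) p852007: `ArchSmooth.classMul`, `stableSumG_orbFamGExt_classMul_eq_ite`; brings `orbFamGExt`, `stableSumG`, `bzClassG`, F0 `bzClassMapG`
import Literature.NumberTheory.Rogawski1990.ArchBouazizClassRangeG             -- ★ (F0P3a-p04 (g27)) p851972: `isCompact_range_esymm_circle` (the one-place elliptic class image is compact)
import Literature.NumberTheory.Rogawski1990.ArchEPGeneratorHead                -- ★ (12′) E1 (LH7-p01 (g7)) p852045: `EPGeneratorAt`, `EPGeneratorAt.exists_forall_ne_zero`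
import Literature.Analysis.Calculus.SmoothCutoffLocalization                   -- ★ (F0P3a-p06 (g20)) p851476: `exists_fin_contDiff_tsupport_subset_ball_sum_eq_one` (finite smooth PoU, pointwise radii)
import HarnessLib

/-!
# EP ASSEMBLY, FILE E3b: the PRODUCT PARTITION OF UNITY over the definite places subordinate to the one-place generator balls, and the LOCALISATION OF THE `G′`-SIDE STABLE SUM
# `SS_α(a′) = Σ_J SS_α((ρ_J ∘ cl) · a′)` (Rogawski 1990 §8.2, §14.2; Shelstad 1979 §4; Bouaziz 1994 §5.1, §6.2)

Topic `NumberTheory/Rogawski1990`; namespace `Literature.NumberTheory.Rogawski1990`.  THEOREMS ONLY (no `def`, no instance, no notation, no axiom, no named fact, no `sorry`).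
Cell `pub/hodgecm-mathlib`, crux H413 (`stmt-HodgeConjecture-24833`), F0∕P3c road «N8-INNER» ROAD B «EULER–POINCARÉ ROAD» (owner LH2-plan (g1)), brick (12′) «EP ASSEMBLY» (census v1 LH7-p01 (g7),
heir LH3-p04 (g7) after 16:59:58Z; CENSUS-E3 v1 `F0/P3c/LH3/LH3-p04/g7/e3/CENSUS-E3.v1.LH3p04g7.md` 4ea0a8286c8e31d7 §1), FILE E3b of the split E3b → E3a → E3.  Count-neutral, gate-free.

THE POINT (CENSUS-E3 §1).  The EP assembly proves H-S4′ ball by ball in CLASS SPACE at the `α`-DEFINITE places `D`.  Two facts make the localisation free of any support bookkeeping: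
(a) at a definite (compact-chart) place EVERY chart point has a unit-triple `w`-class, and the one-place elliptic class image `K = {esymm3 (e^{it_k})_k}` is COMPACT (★ `isCompact_range_esymm_circle`);
(b) a smooth function of the place classes comes OUT of the `G′`-side stable sum (★ F4 `stableSumG_orbFamGExt_classMul_eq_ite`).  So: cover `K` at each `w ∈ D` by finitely many of the balls on
which the one-place generators live (pointwise radii `ε_w(b) > 0`; ★ `exists_fin_contDiff_tsupport_subset_ball_sum_eq_one` gives a smooth finite PoU `Σ_j F_{w,j} = 1` on `K` with
`tsupport F_{w,j} ⊆ ball b_{w,j} (ε_w b_{w,j})`, centres IN `K`), take the PRODUCT `ρ_J(Y) := Π_{w∈D} F_{w,j_w}(Y_w)` (`J = (j_w)_w`; `Σ_J ρ_J = Π_w Σ_j F_{w,j} = 1` on `K^D`, `Finset.prod_univ_sum`), and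
split `a′ ↦ a′_J := (ρ_J ∘ bzClassG α) · a′` (each `ArchSmooth`, ★ `ArchSmooth.classMul`): on EVERY chart `S′` and every `c ∈ RegG S′`,
`stableSumG (orbFamGExt α ν′ a′) S′ c = Σ_J stableSumG (orbFamGExt α ν′ a′_J) S′ c` — on an admissible label `D ∩ S′ = ∅`, so each `bzClassMapG S′ c w` (`w ∈ D`) is a unit-triple class
`∈ K` and the multipliers sum to `1`; on a junk label both sides vanish.  No linearity of `orbFamGExt` in `a′` is used.  §4 packages, at ONE definite place, the generator data of ★ E1
`EPGeneratorAt` (binder `hEP` of E3, discharged by (7) ★ p852141 ∕ (8) ∕ (10) through ★ `ArchEllipticClassTrichotomy`) as CHOICE FUNCTIONS on `K` with «`h ≠ 0` on the ball».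
* §1 `exists_prod_partition_eq_one` — generic: `V` finite, `E` finite-dimensional, `K ⊆ E` compact, radii `ε : V → E → ℝ>0` ⇒ product PoU `= 1` on `K^V`.
* §2 `exists_prod_classPartition` — the same indexed by a `Finset D ⊆ W` of places, as smooth functions of ALL place classes `Y : W → E` (the currency of ★ F4's multipliers).
* §3 `stableSumG_orbFamGExt_eq_sum_classMul` (any finite family of smooth class multipliers summing to `1` at the admissible regular chart points) and the packaged
  **`exists_classPartition_stableSumG`** (`K`, `D := {w ∉ splitChartPlaces L α}`, radii in, PoU + decomposition out).
* §4 `exists_epGenerator_choice` — one definite place: `hEP ⇒` choice functions `ε, f, h` on `K` with the two clauses of ★ `EPGeneratorAt` and `h ≠ 0` on the `ε`-ball.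
HONEST LABEL: HC_CM is proved only modulo the 7 printed citations (2 remaining: hLiu418 = `stmt-HodgeConjecture-24832`, h413 = `stmt-HodgeConjecture-24833`) until rung 0 closes; this file pays
nothing by itself (E3a∕E3 consume it).

## References
* [Rogawski1990] J. D. Rogawski, *Automorphic Representations of Unitary Groups in Three Variables*, Ann. of Math. Stud. 123 (1990), §8.2 p. 122 (orbital integrals place by place), §14.2
  (14.2.1) pp. 232–233 (the inner transfer of `C_c^∞` functions).
* [Shelstad1979] D. Shelstad, *Characters and inner forms of a quasi-split group over ℝ*, Compositio Math. 39 (1979), §4 pp. 22–26 (transfer assembled from local data on the Cartan).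
* [Bouaziz1994IntegralesOrbitales] A. Bouaziz, *Intégrales orbitales sur les groupes de Lie réductifs*, Ann. Sci. ÉNS (4) 27 (1994), §5.1 p. 588, §6.2 pp. 591–594 (partition of unity in
  the space of classes; invariant multipliers).
* [BorelJacquet1979] A. Borel, H. Jacquet, *Automorphic forms and automorphic representations*, Proc. Sympos. Pure Math. 33 (1979), part 1, §4.1 (the archimedean test class).
-/

set_option autoImplicit false

noncomputable section

open MeasureTheory NumberField NumberField.InfinitePlace Complex Set Function Metric Topology
open Literature.NumberTheory.Automorphic Literature.NumberTheory.Automorphic.UnitaryGroup Literature.NumberTheory.Automorphic.ArchCartan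
open Literature.Analysis.Calculus
open scoped Classical MatrixGroups Matrix ContDiff Matrix.Norms.Operator

namespace Literature.NumberTheory.Rogawski1990

/-! ## §1 Product partitions of unity subordinate to pointwise radii -/

section ProductPartition

variable {V : Type*} [Fintype V] [DecidableEq V] {E : Type*} [NormedAddCommGroup E] [NormedSpace ℝ E] [FiniteDimensional ℝ E]

/-- **PRODUCT PARTITION OF UNITY ON `K^V` SUBORDINATE TO PRESCRIBED POINTWISE RADII, ONE FACTOR AT A TIME.**  For a compact `K ⊆ E`, a finite index type `V` and radii `ε v b > 0`:
finitely many centres `ctr v j ∈ K` and smooth compactly supported `0 ≤ F v j ≤ 1` with `tsupport (F v j) ⊆ ball (ctr v j) (ε v (ctr v j))` at each `v` (★ `exists_fin_contDiff_tsupport_subset_ball_sum_eq_one`),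
whose PRODUCTS `Π_v F v (J v) (y v)` over the multi-indices `J` sum to `1` at every `y ∈ K^V` (`Π_v Σ_j = Σ_J Π_v`, `Finset.prod_univ_sum`). [cite: Bouaziz1994IntegralesOrbitales, §6.2 p. 591] -/
theorem exists_prod_partition_eq_one {K : Set E} (hK : IsCompact K) (ε : V → E → ℝ) (hε : ∀ v b, 0 < ε v b) :
    ∃ (n : V → ℕ) (ctr : ∀ v, Fin (n v) → E) (F : ∀ v, Fin (n v) → E → ℝ),
      (∀ v j, ctr v j ∈ K ∧ ContDiff ℝ ∞ (F v j) ∧ HasCompactSupport (F v j) ∧ tsupport (F v j) ⊆ ball (ctr v j) (ε v (ctr v j)) ∧ (∀ x, 0 ≤ F v j x) ∧ ∀ x, F v j x ≤ 1) ∧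
      ∀ y : V → E, (∀ v, y v ∈ K) → ∑ J : (∀ v, Fin (n v)), ∏ v, F v (J v) (y v) = 1 := by
  choose n ctr F hF hsum using fun v => exists_fin_contDiff_tsupport_subset_ball_sum_eq_one hK (ε v) (hε v)
  refine ⟨n, ctr, F, fun v j => hF v j, fun y hy => ?_⟩
  have h := Finset.prod_univ_sum (fun v => (Finset.univ : Finset (Fin (n v)))) fun v j => F v j (y v)
  rw [Fintype.piFinset_univ] at h
  rw [← h]
  exact Finset.prod_eq_one fun v _ => hsum v (y v) (hy v)

end ProductPartition

/-! ## §2 The same over a finite set `D` of places, as functions of all place classes -/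

section Places

variable {W : Type*} [Fintype W] [DecidableEq W] {E : Type*} [NormedAddCommGroup E] [NormedSpace ℝ E] [FiniteDimensional ℝ E]

/-- The one-place elliptic class image `K = range (esymm3 ∘ e^{i·})` is compact (★ `isCompact_range_esymm_circle`, read through `esymm3`). [cite: Rogawski1990, §3.6 p. 28] -/
theorem isCompact_range_esymm3_cexp : IsCompact (Set.range fun t : Fin 3 → ℝ => esymm3 fun i => Complex.exp ((t i : ℂ) * I)) :=
  isCompact_range_esymm_circle

/-- **PRODUCT PARTITION OF UNITY OVER THE PLACES OF `D`**, read as smooth functions of ALL place coordinates `Y : W → E` (depending on `Y|_D` only): `ρ_J Y := Π_{v ∈ D} F v (J v) (Y v)` is `C^∞`,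
`0 ≤ ρ_J`, `ρ_J Y ≠ 0 ⇒ dist (Y v) (ctr v (J v)) < ε v (ctr v (J v))` for every `v ∈ D`, and `Σ_J ρ_J Y = 1` whenever `Y v ∈ K` for all `v ∈ D`. [cite: Bouaziz1994IntegralesOrbitales, §6.2 p. 591] -/
theorem exists_prod_classPartition (D : Finset W) {K : Set E} (hK : IsCompact K) (ε : W → E → ℝ) (hε : ∀ w b, 0 < ε w b) :
    ∃ (n : ↥D → ℕ) (ctr : ∀ v : ↥D, Fin (n v) → E) (F : ∀ v : ↥D, Fin (n v) → E → ℝ),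
      (∀ v j, ctr v j ∈ K ∧ ContDiff ℝ ∞ (F v j) ∧ HasCompactSupport (F v j) ∧ tsupport (F v j) ⊆ ball (ctr v j) (ε v (ctr v j)) ∧ (∀ x, 0 ≤ F v j x) ∧ ∀ x, F v j x ≤ 1) ∧
      (∀ J : (∀ v : ↥D, Fin (n v)), ContDiff ℝ ∞ fun Y : W → E => ∏ v : ↥D, F v (J v) (Y v)) ∧
      (∀ (J : (∀ v : ↥D, Fin (n v))) (Y : W → E), 0 ≤ ∏ v : ↥D, F v (J v) (Y v)) ∧
      (∀ (J : (∀ v : ↥D, Fin (n v))) (Y : W → E), ∏ v : ↥D, F v (J v) (Y v) ≠ 0 → ∀ v : ↥D, dist (Y (v : W)) (ctr v (J v)) < ε v (ctr v (J v))) ∧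
      ∀ Y : W → E, (∀ w ∈ D, Y w ∈ K) → ∑ J : (∀ v : ↥D, Fin (n v)), ∏ v : ↥D, F v (J v) (Y v) = 1 := by
  obtain ⟨n, ctr, F, hF, hsum⟩ := exists_prod_partition_eq_one (V := ↥D) hK (fun v : ↥D => ε (v : W)) fun v b => hε v b
  refine ⟨n, ctr, F, hF, fun J => ?_, fun J Y => Finset.prod_nonneg fun v _ => (hF v (J v)).2.2.2.2.1 _, fun J Y hne v => ?_, fun Y hY => hsum (fun v => Y v) fun v => hY v v.2⟩
  · exact contDiff_prod fun v _ => (hF v (J v)).2.1.comp (contDiff_apply ℝ E (v : W))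
  · -- a non-zero product has every factor non-zero, hence `Y v` in the support ball
    have hv : F v (J v) (Y v) ≠ 0 := fun h0 => hne (Finset.prod_eq_zero (Finset.mem_univ v) h0)
    exact mem_ball.1 ((hF v (J v)).2.2.2.1 (subset_tsupport _ (Function.mem_support.2 hv)))

end Places

/-! ## §3 Localisation of the `G′`-side stable sum by class multipliers -/

section Localise

variable (L : Type) [Field L] [NumberField L] [IsCMField L] (α : Fin 3 → L)
  [MeasurableSpace ↥(arch (↥(maximalRealSubfield L)) L (IsCMField.complexConj L) 3 (Matrix.diagonal α))] [BorelSpace ↥(arch (↥(maximalRealSubfield L)) L (IsCMField.complexConj L) 3 (Matrix.diagonal α))]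
  (ν' : Measure ↥(arch (↥(maximalRealSubfield L)) L (IsCMField.complexConj L) 3 (Matrix.diagonal α))) [IsFiniteMeasureOnCompacts ν'] [ν'.IsMulRightInvariant]

/-- **A FINITE FAMILY OF SMOOTH CLASS MULTIPLIERS SUMMING TO `1` AT THE ADMISSIBLE REGULAR CHART POINTS SPLITS THE STABLE SUM**: `SS(a′) S′ c = Σ_i SS((ρ_i ∘ cl) · a′) S′ c` for `c ∈ RegG S′`
(admissible label: ★ F4 `stableSumG_orbFamGExt_classMul_eq_ite` pulls `ρ_i (bzClassMapG S′ c)` out and they sum to `1`; junk label: both sides are `0`, ★ `orbFamGExt_of_not_admissible`).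
[cite: Bouaziz1994IntegralesOrbitales, §6.2 p. 591] [cite: Shelstad1979, §4 p. 24] -/
theorem stableSumG_orbFamGExt_eq_sum_classMul {ι : Type*} (s : Finset ι) (a' : ↥(arch (↥(maximalRealSubfield L)) L (IsCMField.complexConj L) 3 (Matrix.diagonal α)) → ℂ)
    (ρ : ι → ({w : InfinitePlace L // IsComplex w} → ℂ × ℂ × ℂ) → ℂ)
    (hρ : ∀ (S' : Finset {w : InfinitePlace L // IsComplex w}) (c : {w : InfinitePlace L // IsComplex w} → Fin 3 → ℝ),
      (∀ w, w ∈ S' → w ∈ splitChartPlaces L α) → c ∈ RegG S' → ∑ i ∈ s, ρ i (bzClassMapG S' c) = 1)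
    {S' : Finset {w : InfinitePlace L // IsComplex w}} {c : {w : InfinitePlace L // IsComplex w} → Fin 3 → ℝ} (hc : c ∈ RegG S') :
    stableSumG (orbFamGExt L α ν' a') S' c = ∑ i ∈ s, stableSumG (orbFamGExt L α ν' (fun k => ρ i (bzClassG L α k) * a' k)) S' c := by
  by_cases hS' : ∀ w, w ∈ S' → w ∈ splitChartPlaces L α
  · have h : ∀ i ∈ s, stableSumG (orbFamGExt L α ν' (fun k => ρ i (bzClassG L α k) * a' k)) S' c = ρ i (bzClassMapG S' c) * stableSumG (orbFamGExt L α ν' a') S' c :=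
      fun i _ => by rw [stableSumG_orbFamGExt_classMul_eq_ite L α ν' a' (ρ i) S' hc, if_pos hS']
    rw [Finset.sum_congr rfl h, ← Finset.sum_mul, hρ S' c hS' hc, one_mul]
  · have h : ∀ i ∈ s, stableSumG (orbFamGExt L α ν' (fun k => ρ i (bzClassG L α k) * a' k)) S' c = 0 :=
      fun i _ => by rw [stableSumG_orbFamGExt_classMul_eq_ite L α ν' a' (ρ i) S' hc, if_neg hS', zero_mul]
    rw [Finset.sum_congr rfl h, Finset.sum_const_zero, stableSumG_apply]
    refine Finset.sum_eq_zero fun σ _ => ?_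
    rw [orbFamGExt_of_not_admissible L α ν' a' S' hS', mul_zero]

omit [NumberField L] [IsCMField L] in
/-- At a place OFF the label the `w`-class of a chart point is a unit-triple class: it lies in the compact one-place elliptic class image `K = range (esymm3 ∘ e^{i·})`.
[cite: Rogawski1990, §3.6 p. 28] [cite: Bouaziz1994IntegralesOrbitales, §5.1 p. 588] -/
theorem bzClassMapG_mem_range_of_not_mem {S' : Finset {w : InfinitePlace L // IsComplex w}} {w : {w : InfinitePlace L // IsComplex w}} (hw : w ∉ S')
    (c : {w : InfinitePlace L // IsComplex w} → Fin 3 → ℝ) :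
    bzClassMapG S' c w ∈ Set.range fun t : Fin 3 → ℝ => esymm3 fun i => Complex.exp ((t i : ℂ) * I) :=
  ⟨c w, by rw [bzClassMapG_apply, chartEigG_of_not_mem hw]⟩

/-- **THE CLASS PARTITION OF THE `G′`-SIDE STABLE SUM (E3b head).**  For a house frame `α`, the finite set `D` of the `α`-DEFINITE places (`hD : w ∈ D ↔ w ∉ splitChartPlaces L α`) and radii `ε w b > 0` on class space:
finitely many centres `ctr v j ∈ K` (`v ∈ D`) with smooth `0 ≤ F v j ≤ 1`, `tsupport (F v j) ⊆ ball (ctr v j) (ε v (ctr v j))`, such that the products `ρ_J := Π_{v∈D} F v (J v) ∘ (· v)` are smooth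
class multipliers with (i) `ρ_J Y ≠ 0 ⇒ dist (Y v) (ctr v (J v)) < ε v (ctr v (J v))` (`v ∈ D`), (ii) `Σ_J ρ_J Y = 1` whenever `Y|_D ⊆ K`, and (iii) for EVERY `a′`, every label `S′` and every
`c ∈ RegG S′`: `stableSumG (orbFamGExt α ν′ a′) S′ c = Σ_J stableSumG (orbFamGExt α ν′ ((ρ_J ∘ bzClassG α) · a′)) S′ c` — the pieces `(ρ_J ∘ bzClassG α) · a′` being `ArchSmooth` by ★
`ArchSmooth.classMul`.  (Admissible labels avoid `D`, so each `bzClassMapG S′ c v ∈ K`.) [cite: Bouaziz1994IntegralesOrbitales, §6.2 p. 591] [cite: Shelstad1979, §4 p. 24] [cite: Rogawski1990, §14.2 p. 232] -/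
theorem exists_classPartition_stableSumG (D : Finset {w : InfinitePlace L // IsComplex w}) (hD : ∀ w, w ∈ D ↔ w ∉ splitChartPlaces L α)
    (ε : {w : InfinitePlace L // IsComplex w} → ℂ × ℂ × ℂ → ℝ) (hε : ∀ w b, 0 < ε w b) :
    ∃ (n : ↥D → ℕ) (ctr : ∀ v : ↥D, Fin (n v) → ℂ × ℂ × ℂ) (F : ∀ v : ↥D, Fin (n v) → ℂ × ℂ × ℂ → ℝ),
      (∀ v j, ctr v j ∈ (Set.range fun t : Fin 3 → ℝ => esymm3 fun i => Complex.exp ((t i : ℂ) * I)) ∧ ContDiff ℝ ∞ (F v j) ∧ HasCompactSupport (F v j) ∧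
        tsupport (F v j) ⊆ ball (ctr v j) (ε v (ctr v j)) ∧ (∀ x, 0 ≤ F v j x) ∧ ∀ x, F v j x ≤ 1) ∧
      (∀ J : (∀ v : ↥D, Fin (n v)), ContDiff ℝ ∞ fun Y : {w : InfinitePlace L // IsComplex w} → ℂ × ℂ × ℂ => ∏ v : ↥D, F v (J v) (Y v)) ∧
      (∀ (J : (∀ v : ↥D, Fin (n v))) (Y : {w : InfinitePlace L // IsComplex w} → ℂ × ℂ × ℂ),
          ∏ v : ↥D, F v (J v) (Y v) ≠ 0 → ∀ v : ↥D, dist (Y (v : {w : InfinitePlace L // IsComplex w})) (ctr v (J v)) < ε v (ctr v (J v))) ∧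
      (∀ Y : {w : InfinitePlace L // IsComplex w} → ℂ × ℂ × ℂ,
          (∀ w, w ∉ splitChartPlaces L α → Y w ∈ Set.range fun t : Fin 3 → ℝ => esymm3 fun i => Complex.exp ((t i : ℂ) * I)) →
            ∑ J : (∀ v : ↥D, Fin (n v)), ∏ v : ↥D, F v (J v) (Y v) = 1) ∧
      ∀ (a' : ↥(arch (↥(maximalRealSubfield L)) L (IsCMField.complexConj L) 3 (Matrix.diagonal α)) → ℂ) (S' : Finset {w : InfinitePlace L // IsComplex w})
        (c : {w : InfinitePlace L // IsComplex w} → Fin 3 → ℝ), c ∈ RegG S' →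
        stableSumG (orbFamGExt L α ν' a') S' c =
          ∑ J : (∀ v : ↥D, Fin (n v)), stableSumG (orbFamGExt L α ν' (fun k => ((∏ v : ↥D, F v (J v) (bzClassG L α k v) : ℝ) : ℂ) * a' k)) S' c := by
  obtain ⟨n, ctr, F, hF, hsm, -, hsupp, hsum⟩ := exists_prod_classPartition D isCompact_range_esymm3_cexp ε hε
  refine ⟨n, ctr, F, hF, hsm, hsupp, fun Y hY => hsum Y fun w hw => hY w ((hD w).1 hw), fun a' S' c hc => ?_⟩
  have hρ : ∀ (S'' : Finset {w : InfinitePlace L // IsComplex w}) (c' : {w : InfinitePlace L // IsComplex w} → Fin 3 → ℝ),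
      (∀ w, w ∈ S'' → w ∈ splitChartPlaces L α) → c' ∈ RegG S'' →
        ∑ J : (∀ v : ↥D, Fin (n v)), (fun (J : ∀ v : ↥D, Fin (n v)) (Y : {w : InfinitePlace L // IsComplex w} → ℂ × ℂ × ℂ) =>
          ((∏ v : ↥D, F v (J v) (Y v) : ℝ) : ℂ)) J (bzClassMapG S'' c') = 1 := by
    intro S'' c' hS'' _
    have hmem : ∀ w, w ∈ D → bzClassMapG S'' c' w ∈ Set.range fun t : Fin 3 → ℝ => esymm3 fun i => Complex.exp ((t i : ℂ) * I) :=
      fun w hw => bzClassMapG_mem_range_of_not_mem L (fun h => ((hD w).1 hw) (hS'' w h)) c'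
    have h1 := hsum (bzClassMapG S'' c') hmem
    beta_reduce
    rw [← Complex.ofReal_sum, h1, Complex.ofReal_one]
  exact stableSumG_orbFamGExt_eq_sum_classMul L α ν' Finset.univ a'
    (fun (J : ∀ v : ↥D, Fin (n v)) (Y : {w : InfinitePlace L // IsComplex w} → ℂ × ℂ × ℂ) => ((∏ v : ↥D, F v (J v) (Y v) : ℝ) : ℂ)) hρ hc

end Localise

section Piece

variable (L : Type) [Field L] [NumberField L] [IsCMField L] (α : Fin 3 → L)

/-- The pieces of the class partition are archimedean test functions (★ `ArchSmooth.classMul` with the real multiplier read in `ℂ`). [cite: BorelJacquet1979, §4.1] [cite: Bouaziz1994IntegralesOrbitales, §6.2 p. 591] -/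
theorem archSmooth_classPartition_piece {a' : ↥(arch (↥(maximalRealSubfield L)) L (IsCMField.complexConj L) 3 (Matrix.diagonal α)) → ℂ} (ha' : ArchSmooth L 3 (Matrix.diagonal α) a')
    {ρ : ({w : InfinitePlace L // IsComplex w} → ℂ × ℂ × ℂ) → ℝ} (hρ : ContDiff ℝ ∞ ρ) :
    ArchSmooth L 3 (Matrix.diagonal α) (fun k => ((ρ (bzClassG L α k) : ℝ) : ℂ) * a' k) :=
  ArchSmooth.classMul L α ha' (F := fun Y => ((ρ Y : ℝ) : ℂ)) (Complex.ofRealCLM.contDiff.comp hρ)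

end Piece

/-! ## §4 One definite place: the generator data of `hEP` as choice functions on the class image -/

section Choice

variable (L : Type) [Field L] [NumberField L] [IsCMField L] (β : Fin 3 → L) (w : {w : InfinitePlace L // IsComplex w})
  [MeasurableSpace ↥(archLocal L 3 (Matrix.diagonal β) w)] [BorelSpace ↥(archLocal L 3 (Matrix.diagonal β) w)]
  (νw : Measure ↥(archLocal L 3 (Matrix.diagonal β) w)) [νw.IsHaarMeasure] [νw.IsMulRightInvariant]

/-- **GENERATOR CHOICE AT ONE PLACE.**  If every elliptic class of `U(β)_w` carries an EP generator (`hEP`, ★ `EPGeneratorAt`; discharged by (7) ★ `epGeneratorAt_esymm3_of_injective` ∕ (8) ∕ (10)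
through ★ `forall_unit_esymm3_of_regular_wall_corner_circle`), there are CHOICE FUNCTIONS `ε, f, h` on class space — `ε > 0` everywhere — such that at every point `b` of the elliptic class
image `K`: `f b` is a one-place test function (ambient `C^∞` + compact support), `h b` is smooth with `h b ≠ 0` ON THE WHOLE `ε b`-BALL (★ `EPGeneratorAt.exists_forall_ne_zero`), the split
reading of `f b` vanishes and the compact stable reading of `f b` equals `h b ∘ class` at the regular chart points whose `w`-class is `ε b`-close to `b`.
[cite: Rogawski1990, §8.2 p. 122] [cite: Shelstad1979, §4 p. 22] [cite: Bouaziz1994IntegralesOrbitales, §6.2 p. 591] -/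
theorem exists_epGenerator_choice (hEP : ∀ l : Fin 3 → ℂ, (∀ i, ‖l i‖ = 1) → EPGeneratorAt L β w νw (esymm3 l)) :
    ∃ (ε : ℂ × ℂ × ℂ → ℝ) (f : ℂ × ℂ × ℂ → ↥(archLocal L 3 (Matrix.diagonal β) w) → ℂ) (h : ℂ × ℂ × ℂ → ℂ × ℂ × ℂ → ℂ),
      (∀ b, 0 < ε b) ∧
      ∀ b ∈ (Set.range fun t : Fin 3 → ℝ => esymm3 fun i => Complex.exp ((t i : ℂ) * I)),
        (∃ fa : Matrix (Fin 3) (Fin 3) ℂ → ℂ, ContDiff ℝ ∞ fa ∧ ∀ g, f b g = fa ((g : GL (Fin 3) ℂ) : Matrix (Fin 3) (Fin 3) ℂ)) ∧ HasCompactSupport (f b) ∧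
        ContDiff ℝ ∞ (h b) ∧ (∀ z, dist z b < ε b → h b z ≠ 0) ∧
        (∀ (S' : Finset {w : InfinitePlace L // IsComplex w}) (c : {w : InfinitePlace L // IsComplex w} → Fin 3 → ℝ),
            w ∈ S' → c w 0 ≠ 0 → dist (bzClassMapG S' c w) b < ε b → chartOrbGLoc L β w S' νw (f b) (c w) = 0) ∧
        (∀ (S' : Finset {w : InfinitePlace L // IsComplex w}) (c : {w : InfinitePlace L // IsComplex w} → Fin 3 → ℝ),
            w ∉ S' → (Function.Injective fun i : Fin 3 => Circle.exp (c w i)) → dist (bzClassMapG S' c w) b < ε b →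
              ∑ σ : Equiv.Perm (Fin 3), chartOrbGLoc L β w S' νw (f b) (c w ∘ σ) = h b (bzClassMapG S' c w)) := by
  -- at each point of `K` the head holds, with `h ≠ 0` on the ball
  have hK : ∀ b ∈ (Set.range fun t : Fin 3 → ℝ => esymm3 fun i => Complex.exp ((t i : ℂ) * I)),
      ∃ ε : ℝ, 0 < ε ∧ ∃ f : ↥(archLocal L 3 (Matrix.diagonal β) w) → ℂ,
        (∃ fa : Matrix (Fin 3) (Fin 3) ℂ → ℂ, ContDiff ℝ ∞ fa ∧ ∀ g, f g = fa ((g : GL (Fin 3) ℂ) : Matrix (Fin 3) (Fin 3) ℂ)) ∧ HasCompactSupport f ∧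
        ∃ h : ℂ × ℂ × ℂ → ℂ, ContDiff ℝ ∞ h ∧ (∀ z, dist z b < ε → h z ≠ 0) ∧
          (∀ (S' : Finset {w : InfinitePlace L // IsComplex w}) (c : {w : InfinitePlace L // IsComplex w} → Fin 3 → ℝ),
              w ∈ S' → c w 0 ≠ 0 → dist (bzClassMapG S' c w) b < ε → chartOrbGLoc L β w S' νw f (c w) = 0) ∧
          (∀ (S' : Finset {w : InfinitePlace L // IsComplex w}) (c : {w : InfinitePlace L // IsComplex w} → Fin 3 → ℝ),
              w ∉ S' → (Function.Injective fun i : Fin 3 => Circle.exp (c w i)) → dist (bzClassMapG S' c w) b < ε →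
                ∑ σ : Equiv.Perm (Fin 3), chartOrbGLoc L β w S' νw f (c w ∘ σ) = h (bzClassMapG S' c w)) := by
    rintro b ⟨t, rfl⟩
    exact (hEP _ fun i => by exact Complex.norm_exp_ofReal_mul_I (t i)).exists_forall_ne_zero
  choose! ε hε f hf hfs h hh hh0 hsplit hcpt using hK
  refine ⟨fun b => if b ∈ (Set.range fun t : Fin 3 → ℝ => esymm3 fun i => Complex.exp ((t i : ℂ) * I)) then ε b else 1, f, h, fun b => ?_, fun b hb => ?_⟩
  · show 0 < (if b ∈ (Set.range fun t : Fin 3 → ℝ => esymm3 fun i => Complex.exp ((t i : ℂ) * I)) then ε b else 1)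
    by_cases hb : b ∈ (Set.range fun t : Fin 3 → ℝ => esymm3 fun i => Complex.exp ((t i : ℂ) * I))
    · rw [if_pos hb]; exact hε b hb
    · rw [if_neg hb]; exact one_pos
  · simp only [if_pos hb]
    exact ⟨hf b hb, hfs b hb, hh b hb, hh0 b hb, hsplit b hb, hcpt b hb⟩

end Choice

end Literature.NumberTheory.Rogawski1990

end
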